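import Summits.QuantumFields.YangMills.Theorems.BalabanLadderIRStubShellRung

/-!
# Strong-coupling total-variation mixing for ALL data and every sub-region — BC5 rung of the cell-tempered IR line

Route `route-QuantumFields-BalabanLadder`, crux `IR` (stmt-QuantumFields-19354), registered line L2″ «cell-tempered
certificate» (skeleton v6, ym-beyond seat P2, route owner).  Mathlib + the project tree only.

The landed module `BalabanLadderIRStubRungStrong` (F1) proves the high-temperature density-ratio bound but STATES it
behind an existential tempered class `∃ T` (its proof takes `T = univ`).  The cell-tempered line needs the bound for
ALL pairs of exterior data and EVERY sub-region `Y ⊆ window` containing the central cell, which is what F1's proof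
actually shows; this module restates exactly that (`tv_strong_coupling_all`, proof = F1's first bullet over F1's
helper lemmas, cited by name) and derives the registered rung `stub_cellRung` of skeleton v6 in closed form
(`stub_cellRung_proved`: the cell-tempered condition at cell side 1, window 1, every rarity budget `δ ≥ 0`, with
`Good ≡ univ`).

Sources: Osterwalder–Seiler, Ann. Phys. 110 (1978) (strong-coupling cluster expansion regime); Seiler, LNP 159 (1982);
the density-ratio form is folklore (Georgii, *Gibbs Measures and Phase Transitions*, 2nd ed. 2011, §8.1).
-/

set_option autoImplicit false

noncomputable section

open MeasureTheory
open Literature.MathematicalPhysics.QuantumFieldTheory Literature.MathematicalPhysics.QuantumLattice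
open Literature.Probability.LatticeModels
open Summit.QuantumFields.YangMills.Cruxes.IR.ShellTempered (windowCellsPlus)

namespace Summit.QuantumFields.YangMills.Cruxes.IR.Tempered

/-- **Strong-coupling TV mixing, all data, every sub-region.**  For every compact `G`, every continuous matrix
representation `ρ` and every `ε > 0` there is `β_D > 0` such that for `|β| ≤ β_D`, every mesh-1 frame `w`, every
sub-region `Y ⊆ window(1)` containing the central cell, EVERY pair of exterior data `η, η'` and every `[0,1]`-valued
measurable cylinder `f` of the central cell, the kernel expectations of `f` over the edges of `Y` differ by at most
`ε`.  Proof: both expectations are density ratios over the same product Haar measure with weights in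
`[e^{-A}, e^{A}]`, `A = |β|·(N + C_ρ)·#plaquettes ≤ |β|·K`, hence lie in `[e^{-2A} m, e^{2A} m]` with `m ∈ [0,1]`,
and `e^{2A} − e^{-2A} ≤ 8A ≤ ε`. [folklore; Osterwalder–Seiler 1978] -/
theorem tv_strong_coupling_all :
    ∀ (G : Type) [Group G] [TopologicalSpace G] [IsTopologicalGroup G] [CompactSpace G]
      [MeasurableSpace G] [BorelSpace G] (N : ℕ) (ρ : G →* Matrix (Fin N) (Fin N) ℂ), Continuous ρ →
      ∀ ε : ℝ, 0 < ε → ∃ β_D : ℝ, 0 < β_D ∧ ∀ β : ℝ, |β| ≤ β_D →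
        ∀ w : Fin 4 → ℤ → ℤ,
          (∀ i j, w i j + ((1 : ℕ) : ℤ) ≤ w i (j + 1) ∧ w i (j + 1) ≤ w i j + 2 * ((1 : ℕ) : ℤ)) →
          ∀ Y : Finset (Fin 4 → ℤ), Y ⊆ windowCells 1 → (0 : Fin 4 → ℤ) ∈ Y →
            ∀ η η' : LGConfig 4 G, ∀ f : LGConfig 4 G → ℝ, IsCylinder f (cellEdges w 0) → Measurable f →
              (∀ U, 0 ≤ f U ∧ f U ≤ 1) →
              |(∫ U, f U ∂(ymSpecification ρ β (regionEdges w Y) η)) -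
                ∫ U, f U ∂(ymSpecification ρ β (regionEdges w Y) η')| ≤ ε := by
  intro G _ _ _ _ _ _ N ρ hρ ε hε
  obtain ⟨C, hC0, hC⟩ := Literature.MathematicalPhysics.QuantumLattice.exists_forall_abs_plaquetteObs_le (d := 4) ρ hρ
  -- uniform bound on the number of plaquettes touching an admissible kernel region
  set P : ℕ := (1 + 4) * Fintype.card {p : Fin 4 × Fin 4 // p.1 < p.2} * 40000 with hP
  set K : ℝ := ((N : ℝ) + C) * P + 1 with hK
  have hNC : 0 ≤ (N : ℝ) + C := by positivity
  have hKpos : 0 < K := by positivity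
  refine ⟨min (1 / (2 * K)) (ε / (8 * K)), lt_min (by positivity) (by positivity), fun β hβ => ?_⟩
  have hβ1 : |β| ≤ 1 / (2 * K) := hβ.trans (min_le_left _ _)
  have hβ2 : |β| ≤ ε / (8 * K) := hβ.trans (min_le_right _ _)
  intro w hw Y hY h0Y η η' f hf_cyl hfm hf01
  set Λ : Finset (Literature.MathematicalPhysics.QuantumLattice.ZdEdge 4) := regionEdges w Y with hΛ
  -- the constant `A` and its smallness
  have hcardΛ : Λ.card ≤ 40000 := card_regionEdges_le w hw Y hY
  have hcardP : (plaquettesTouching Λ).card ≤ P :=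
    (Literature.MathematicalPhysics.QuantumLattice.card_plaquettesTouching_le Λ).trans (Nat.mul_le_mul_left _ hcardΛ)
  set A : ℝ := |β| * (((N : ℝ) + C) * (plaquettesTouching Λ).card) with hA
  have hA0 : 0 ≤ A := by positivity
  have hAK : A ≤ |β| * K := by
    refine mul_le_mul_of_nonneg_left ?_ (abs_nonneg β)
    have : ((N : ℝ) + C) * (plaquettesTouching Λ).card ≤ ((N : ℝ) + C) * P :=
      mul_le_mul_of_nonneg_left (by exact_mod_cast hcardP) hNC
    linarith
  have hβK1 : |β| * K ≤ 1 / 2 := by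
    calc |β| * K ≤ 1 / (2 * K) * K := mul_le_mul_of_nonneg_right hβ1 hKpos.le
      _ = 1 / 2 := by field_simp
  have hβK2 : |β| * K ≤ ε / 8 := by
    calc |β| * K ≤ ε / (8 * K) * K := mul_le_mul_of_nonneg_right hβ2 hKpos.le
      _ = ε / 8 := by field_simp
  have h2A : 2 * A ≤ 1 := by linarith
  have h8A : 8 * A ≤ ε := by linarith
  -- the weight and its two-sided bound
  have hwt : ∀ U : LGConfig 4 G, Real.exp (-A) ≤ Real.exp (-β * wilsonBoundaryAction ρ Λ U) ∧
      Real.exp (-β * wilsonBoundaryAction ρ Λ U) ≤ Real.exp A := by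
    intro U
    have hS := Literature.MathematicalPhysics.QuantumLattice.abs_wilsonBoundaryAction_le ρ hC Λ U
    have hb : |-β * wilsonBoundaryAction ρ Λ U| ≤ A := by
      rw [abs_mul, abs_neg]
      exact mul_le_mul_of_nonneg_left hS (abs_nonneg β)
    rw [abs_le] at hb
    exact ⟨Real.exp_le_exp.2 hb.1, Real.exp_le_exp.2 hb.2⟩
  have hwm : ∀ ξ : LGConfig 4 G, Measurable fun ζ : ↥Λ → G =>
      Real.exp (-β * wilsonBoundaryAction ρ Λ (glueWith Λ ζ ξ)) := fun ξ =>
    (measurable_wilsonWeight_of_continuous ρ hρ β Λ).comp (measurable_glueWith Λ ξ)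
  -- the kernel expectations as density ratios over the product Haar measure
  set π : Measure (↥Λ → G) := Measure.pi fun _ : ↥Λ => haarProbability G with hπ
  haveI : IsProbabilityMeasure π := by rw [hπ]; infer_instance
  rw [integral_ymSpecification_of_continuous ρ hρ β Λ hfm η,
    integral_ymSpecification_of_continuous ρ hρ β Λ hfm η']
  -- `F(ζ) = f (ζ η_{Λᶜ})` does not depend on the exterior datum: the central cell lies in `Λ`
  have hSΛ : cellEdges w 0 ⊆ Λ := cellEdges_subset_regionEdges w h0Y
  have hFeq : ∀ ζ : ↥Λ → G, f (glueWith Λ ζ η') = f (glueWith Λ ζ η) := fun ζ =>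
    hf_cyl fun e he => by
      have heΛ : e ∈ Λ := hSΛ (Finset.mem_coe.1 he)
      rw [glueWith_apply_mem _ _ _ heΛ, glueWith_apply_mem _ _ _ heΛ]
  have hNum' : (∫ ζ, f (glueWith Λ ζ η') * Real.exp (-β * wilsonBoundaryAction ρ Λ (glueWith Λ ζ η')) ∂π) =
      ∫ ζ, f (glueWith Λ ζ η) * Real.exp (-β * wilsonBoundaryAction ρ Λ (glueWith Λ ζ η')) ∂π :=
    integral_congr_ae (Filter.Eventually.of_forall fun ζ => by simp only [hFeq])
  rw [hNum']
  have hFm : Measurable fun ζ : ↥Λ → G => f (glueWith Λ ζ η) := hfm.comp (measurable_glueWith Λ η)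
  have hF01 : ∀ ζ : ↥Λ → G, 0 ≤ f (glueWith Λ ζ η) ∧ f (glueWith Λ ζ η) ≤ 1 := fun ζ => hf01 _
  obtain ⟨hlo, hhi⟩ := ratio_bounds π hFm hF01 (hwm η) (A := A) fun ζ => hwt _
  obtain ⟨hlo', hhi'⟩ := ratio_bounds π hFm hF01 (hwm η') (A := A) fun ζ => hwt _
  -- `m = ∫ F dπ ∈ [0, 1]`
  set m := ∫ ζ, f (glueWith Λ ζ η) ∂π with hm
  have hm0 : 0 ≤ m := integral_nonneg fun ζ => (hF01 ζ).1
  have hm1 : m ≤ 1 := by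
    have hFi : Integrable (fun ζ : ↥Λ → G => f (glueWith Λ ζ η)) π :=
      Literature.MathematicalPhysics.QuantumLattice.integrable_of_bound hFm.aestronglyMeasurable (C := 1) fun ζ => by
        rw [abs_le]; exact ⟨by linarith [(hF01 ζ).1], (hF01 ζ).2⟩
    have h := integral_mono hFi (integrable_const (1 : ℝ)) fun ζ => (hF01 ζ).2
    simpa using h
  have hUL : 0 ≤ Real.exp (2 * A) - Real.exp (-(2 * A)) :=
    sub_nonneg.2 (Real.exp_le_exp.2 (by linarith))
  have hgap : Real.exp (2 * A) - Real.exp (-(2 * A)) ≤ 8 * A := exp_gap_le hA0 h2A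
  have hspan : (Real.exp (2 * A) - Real.exp (-(2 * A))) * m ≤ ε :=
    calc (Real.exp (2 * A) - Real.exp (-(2 * A))) * m
          ≤ (Real.exp (2 * A) - Real.exp (-(2 * A))) * 1 := mul_le_mul_of_nonneg_left hm1 hUL
      _ ≤ ε := by rw [mul_one]; exact hgap.trans h8A
  exact abs_sub_le_of_bounds hlo hhi hlo' hhi' hspan

/-- **The registered rung `stub_cellRung` of skeleton v6, closed form** (statement = the body of
`CellTempered.CellTemperedCond ρ β 1 1 ε δ` unfolded, quantified as in the stub): at strong coupling the
cell-tempered condition holds with the trivial good events `Good ≡ univ` — clause (i) for ALL pairs of data and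
every sub-region by `tv_strong_coupling_all`, clause (ii) because `univᶜ = ∅`. -/
theorem stub_cellRung_proved :
    ∀ (G : Type) [Group G] [TopologicalSpace G] [IsTopologicalGroup G] [CompactSpace G]
      [MeasurableSpace G] [BorelSpace G] (N : ℕ) (ρ : G →* Matrix (Fin N) (Fin N) ℂ), Continuous ρ →
      ∀ ε : ℝ, 0 < ε → ∃ β_D : ℝ, 0 < β_D ∧ ∀ β : ℝ, |β| ≤ β_D → ∀ δ : ℝ, 0 ≤ δ →
        ∀ w : Fin 4 → ℤ → ℤ,
          (∀ i j, w i j + ((1 : ℕ) : ℤ) ≤ w i (j + 1) ∧ w i (j + 1) ≤ w i j + 2 * ((1 : ℕ) : ℤ)) →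
          ∃ Good : (Fin 4 → ℤ) → Set (LGConfig 4 G),
            (∀ c, MeasurableSet (Good c)) ∧
            (∀ c, DependsOn (fun σ : LGConfig 4 G => σ ∈ Good c) ↑(cellEdges w c)) ∧
            (∀ Y : Finset (Fin 4 → ℤ), Y ⊆ windowCells 1 → (0 : Fin 4 → ℤ) ∈ Y →
              ∀ σ σ' : LGConfig 4 G,
                (∀ c ∈ windowCellsPlus 1, c ∉ Y →
                  ((∀ e ∈ cellEdges w c, σ e = σ' e) ∨ (σ ∈ Good c ∧ σ' ∈ Good c))) →
                ∀ f : LGConfig 4 G → ℝ, IsCylinder f (cellEdges w 0) → Measurable f →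
                  (∀ U, 0 ≤ f U ∧ f U ≤ 1) →
                  |(∫ U, f U ∂(ymSpecification ρ β (regionEdges w Y) σ)) -
                    ∫ U, f U ∂(ymSpecification ρ β (regionEdges w Y) σ')| ≤ ε) ∧
            (∀ c : Fin 4 → ℤ, ∀ E' : Finset (Literature.MathematicalPhysics.QuantumLattice.ZdEdge 4),
              cellEdges w c ⊆ E' → ∀ ζ : LGConfig 4 G,
                (ymSpecification ρ β E' ζ) (Good c)ᶜ ≤ ENNReal.ofReal δ) := by
  intro G _ _ _ _ _ _ N ρ hρ ε hε
  obtain ⟨β_D, hβ_D, hTV⟩ := tv_strong_coupling_all G N ρ hρ ε hε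
  refine ⟨β_D, hβ_D, fun β hβ δ _ w hw => ⟨fun _ => Set.univ, fun _ => MeasurableSet.univ, ?_, ?_, ?_⟩⟩
  · intro c σ σ' _
    simp only [Set.mem_univ]
  · intro Y hY h0Y σ σ' _ f hf_cyl hfm hf01
    exact hTV β hβ w hw Y hY h0Y σ σ' f hf_cyl hfm hf01
  · intro c E' _ ζ
    simp only [Set.compl_univ, measure_empty, zero_le]

end Summit.QuantumFields.YangMills.Cruxes.IR.Tempered

end
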